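import Summits.Parity.GeneralizedHardyLittlewood.Theses.PrimeLevelFamEdge
import HarnessLib

/-!
# `BeyondDiagonalBeatsQuarter` (route `PrimeLevelFamEdge`, rev 3): the edge demand, rev-3 re-land

Route `PrimeLevelFamEdge` (cell landau-siegel §D, BIRTH (2)) splits its deciding content into
K_A `MomentsBeyondDiagonal` (∃ a window `Δ > 1` carrying the KMV moment asymptotics) and
K_B `BeyondDiagonalBeatsQuarter` (rev 2: ∀ windows `Δ > 1`, ∀ functionals `T₁ T₂` with the
asymptotics on `(0, Δ]`, SOME sub-window `(a, b) ⊂ [1, Δ]`, `a < 3/2`, beats `¼`; rev 3 prefixes the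
printed first-moment fact `FirstMomentPrinted` = `bettin2017_theorem11_primeLevel` as antecedent, so
the lemmas below carry it as the extra binder `hF`). Because K_A is
existential in the length while K_B is universal over `(Δ, T₁, T₂)` with a downward-closed
hypothesis, the pair still forces beating sub-windows ARBITRARILY CLOSE to the diagonal `Δ = 1⁺`:

* `edge_of_firstMoment_and_beatsQuarter` — K_B (given the printed fact): any pair matching the
  asymptotics on some window `Δ > 1` has beating sub-windows inside `[1, 1+δ]` for every `δ > 0`
  (the restriction of `MomentAsymptotics` to a shorter window is definitional and inlined);
* `edge_limsup_of_moments_firstMoment_and_beatsQuarter` — K_A ∧ FirstMomentPrinted ∧ K_B ⇒ the K_A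
  functionals have beating sub-windows inside `[1, 1+δ]` for every `δ > 0` (lim-sup form; the profile
  may depend on `δ`).

WHY A NEW FILE (rev-3 re-land, ls-knife-typer-3 g10 for ls-Bfam-plan g3 / ls-ref-1): the rev-2 file
`Theorems/BeyondDiagonalBeatsQuarter/Negative/EdgeDemand.lean` states `edge_of_beyondDiagonalBeatsQuarter`
/ `edge_limsup_of_moments_and_beatsQuarter` WITHOUT the binder `hF`; after the route edit 2437b0f57bb2
(K_B := printed first-moment fact → C′ body) those rev-2 statements are unprovable and that file no
longer builds, while the gate's Theorems append-only rule refuses both mutating and removing them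
(`theorems.append-only`, dry-runs 2026-08-27T11:0xZ). The rev-3 statements therefore live here under
new names; the rev-2 file awaits an operator maintenance retirement.

So the load-bearing content of K_A ∧ K_B(rev 2) INCLUDES a statement at the diagonal edge, where the
one-piece envelope's slack `(Δ'−1)/(4(1+Δ'))` tends to `0`. Refuter's erratum to its own pre-read
(ls-ref-1 g4, VERDICTS §31 ERRATUM): rev 1/2 (K_B := C′) weakened rev 0's neighbourhood form to this
lim-sup form but did not remove it; a germ-free design merges existence and value into one
existential crux (typed in the refuter's scratch `FamGermProbe.lean`, planner's call). Standard axioms.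
«The programme SEARCHES and TYPES; no claim about Landau–Siegel zeros, Theorems 1–2 of
arXiv:2211.02515 or a repaired Margin232 until a kernel theorem says so.»

## References

* [KowalskiMichelVanderKam2000] E. Kowalski, P. Michel, J. VanderKam, J. reine angew. Math. 526
  (2000) 1–34: Thm. 6.1 (32), §2 footnote 2 (the envelope `Δ/(2(1+Δ))`, `= ¼` exactly at `Δ = 1`).
  [held: paper:doi-10-1515-crll-2000-074]
-/

namespace Summit.Parity.GeneralizedHardyLittlewood.Theorems.BeyondDiagonalBeatsQuarter.Negative

open Polynomial
open Literature.NumberTheory.LFunctions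
open Summit.Parity.GeneralizedHardyLittlewood.Theses.PrimeLevelFamEdge

/-- **K_B alone forces the edge:** any pair `T₁, T₂` matching the asymptotics on SOME window `Δ > 1`
has, for every `δ > 0`, a beating sub-window inside `[1, 1+δ]` (apply K_B at `min Δ (1+δ)`).
[cite: KowalskiMichelVanderKam2000, §2 footnote 2] -/
theorem edge_of_firstMoment_and_beatsQuarter (hF : FirstMomentPrinted) (hB : BeyondDiagonalBeatsQuarter)
    {T₁ T₂ : ℝ → ℝ[X] → ℝ[X] → ℝ} {Δ : ℝ} (hΔ : 1 < Δ) (hMA : KMV2000.MomentAsymptotics 1 Δ T₁ T₂)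
    {δ : ℝ} (hδ : 0 < δ) :
    ∃ a b : ℝ, 1 ≤ a ∧ a < b ∧ b ≤ 1 + δ ∧ ∃ P : ℝ[X], KMV2000.Admissible P ∧
      ∀ Δ' : ℝ, a < Δ' → Δ' < b →
        1 / 4 < (KMV2000.linForm Δ' P 1 + T₁ Δ' P 1) ^ 2 /
          (2 * (KMV2000.secondMomentForm Δ' P 1 + T₂ Δ' P 1)) := by
  have h1 : 1 < min Δ (1 + δ) := lt_min hΔ (by linarith)
  obtain ⟨a, b, ha, hab, hb, -, P, hP, hval⟩ :=
    hB hF _ h1 T₁ T₂ (fun P Q hP hQ Δ₀ h0 h2 => hMA P Q hP hQ Δ₀ h0 (h2.trans (min_le_left Δ (1 + δ))))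
  exact ⟨a, b, ha, hab, le_trans hb (min_le_right _ _), P, hP, hval⟩

/-- **K_A ∧ FirstMomentPrinted ∧ K_B(rev 3) ⇒ the edge demand, lim-sup form:** for the K_A functionals,
for EVERY `δ > 0`
there is a beating sub-window inside `[1, 1+δ]`. [cite: KowalskiMichelVanderKam2000, §2 footnote 2] -/
theorem edge_limsup_of_moments_firstMoment_and_beatsQuarter (hA : MomentsBeyondDiagonal)
    (hF : FirstMomentPrinted) (hB : BeyondDiagonalBeatsQuarter) :
    ∃ T₁ T₂ : ℝ → ℝ[X] → ℝ[X] → ℝ, (∃ Δ : ℝ, 1 < Δ ∧ KMV2000.MomentAsymptotics 1 Δ T₁ T₂) ∧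
      ∀ δ : ℝ, 0 < δ → ∃ a b : ℝ, 1 ≤ a ∧ a < b ∧ b ≤ 1 + δ ∧ ∃ P : ℝ[X], KMV2000.Admissible P ∧
        ∀ Δ' : ℝ, a < Δ' → Δ' < b →
          1 / 4 < (KMV2000.linForm Δ' P 1 + T₁ Δ' P 1) ^ 2 /
            (2 * (KMV2000.secondMomentForm Δ' P 1 + T₂ Δ' P 1)) := by
  obtain ⟨Δ, hΔ, T₁, T₂, hMA⟩ := hA
  exact ⟨T₁, T₂, ⟨Δ, hΔ, hMA⟩, fun δ hδ => edge_of_firstMoment_and_beatsQuarter hF hB hΔ hMA hδ⟩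

end Summit.Parity.GeneralizedHardyLittlewood.Theorems.BeyondDiagonalBeatsQuarter.Negative
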